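import Literature.Analysis.FluidPDE.NashGeometricLemma
import HarnessLib

/-!
# The geometric lemma with RATIONAL UNIT directions and rational unit normals (every `d ≥ 2`):
# `θ ∈ 𝕊^{d-1} ∩ ℚ^d`, `η ∈ 𝕊^{d-1} ∩ ℚ^d`, `θ · η = 0`, `R = ∑ Γ_θ(R)² θ ⊗ θ` near `Id`

A. Cheskidov, M. Dai, S. Palasek, *Instantaneous Type I blow-up and non-uniqueness of smooth
solutions of the Navier–Stokes equations*, arXiv:2511.09556 (2025), §3.2 ("Geometry of the
building blocks") opens with:

> Choose some `θ_j, η_j ∈ 𝕊^{d-1} ∩ ℚ^d` such that `θ_j · η_j = 0` for all `j`, and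
> `(θ_j ⊗ θ_j)_j` … generate `Id` with positive coefficients. Fixing `m_*` … such that
> `m_* η_j ∈ ℤ^d` for all `j`, we ensure that `N_{j,k} η_j ∈ ℤ^d` for all `j` and `k`,

and the proof of Lemma 3.2 there uses "the well-known rank-one decomposition
`S = ∑_j Γ_j²(S) θ_j ⊗ θ_j` for all `S ∈ Sym^d(ℝ)` in a `c₀`-neighborhood of `Id`, where
`Γ_j : B(Id, c₀) → ℝ` are smooth". Rationality of BOTH unit vectors is what the construction
consumes: the cylinders `𝒞_{j,k}` have the periodic axis `ℝθ_j`, and the oscillation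
`sin(N_{j,k} η_j · x)` must be `2π`-periodic. The tree's geometric lemma
`Literature.Analysis.FluidPDE.NashGeometric.geometric_lemma` (Cheskidov–Luo 2022, Lemma 4.2, every
`d ≥ 2`) decomposes along the lattice directions `e_i`, `e_i ± 2e_j`, whose UNIT vectors
`(e_i ± 2e_j)/√5` are irrational and admit no rational unit normal; this file proves the variant
the paper needs, with explicit data built from the Pythagorean triple `(3, 4, 5)`:

* directions `NashGeometricRational.dir x ∈ ℤ^d`, `x : NashGeometric.Index d = d ⊕ (P ⊕ P)`
  (`P = {(i,j) : i ≠ j}`): `5e_i`, `3e_i + 4e_j`, `3e_i - 4e_j`, all of squared length `25`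
  (`sum_sq_dir`), with unit vectors `theta x = dir x / 5 ∈ ℚ^d` (`sum_sq_theta`,
  `five_mul_theta`);
* normals `NashGeometricRational.perp x ∈ ℤ^d`: `5e_{i'}` (`i' ≠ i`, `other_ne`, using `d ≥ 2`),
  `4e_i - 3e_j`, `4e_i + 3e_j`, of squared length `25`, orthogonal to `dir x`
  (`sum_dir_mul_perp`), with unit vectors `eta x = perp x / 5` (`sum_sq_eta`,
  `sum_theta_mul_eta`, `five_mul_eta`) — so `m_* = 5` serves for every `d`;
* squared coefficients `coeffSq`, AFFINE in `M`: `Γ²_{5e_i}(M) = M_ii - 1/2`,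
  `Γ²_{3e_i ± 4e_j}(M) = (25/48)(2r_d ± M_ij)`, `r_d = 6/(25(d-1))` (`radius`);
* the LINEAR identity `∑_x Γ_x²(M) (k_x)_a (k_x)_b = 25 (M_ab + M_ba)/2` for every matrix `M`
  (`sum_coeffSq_mul_dir_mul_dir`; the calibration is `50 · (25/48 · 2r_d) · (d-1) = 25/2`), whence
  `M = ∑_x Γ_x(M)² θ_x ⊗ θ_x` for symmetric `M` on the closed sup-ball `B̄(Id, 2r_d)`
  (`decomposition_theta`), where all `Γ_x² ≥ 0`;
* `Γ_x = √(Γ_x²)` is `C^∞` on the open sup-ball `B(Id, 2r_d)` (`contDiffOn_coeff`), with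
  `Γ_x² ≥ r_d/2` on `B̄(Id, r_d)` (`le_coeffSq`) and all derivatives bounded on `B̄(Id, r_d)`
  (`exists_bound_iteratedFDeriv_coeff`);
* the package `geometric_lemma` in the shape consumed by §3.2 / Lemma 3.2 of the paper.

The index set has `d + 2d(d-1)` members rather than the `J_d = d(d+1)/2` of the printed sentence
(which also asks for linear independence); the construction uses only finiteness of the family,
the rank-one decomposition with smooth `Γ_j` near `Id`, and the rational unit pairs `(θ_j, η_j)`,
all of which are provided here — linear independence is not used in the paper beyond that
sentence. `-- TODO(general form): a linearly independent rational subfamily of size J_d`.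

## Design

As in `NashGeometricLemma`: `Sym^d` is rendered inside `d → d → ℝ` (sup norm) with a symmetry
hypothesis, `Id = NashGeometric.idMat`; the index type, `idMat` and the double-sum bookkeeping
lemmas are REUSED from that file (imported), only the numerical data change.

## References

* A. Cheskidov, M. Dai, S. Palasek, arXiv:2511.09556 (2025), §3.2 (first paragraph) and the
  proof of Lemma 3.2 (rank-one decomposition near `Id`). [`CheskidovDaiPalasek2025`]
* A. Cheskidov, X. Luo, Invent. Math. 229 (2022) = arXiv:2009.06596, §4.1 Lemma 4.2 (the device,
  after J. Nash 1954). [`CheskidovLuo2022`]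
-/

noncomputable section

open Set Metric Finset
open scoped ContDiff

namespace Literature.Analysis.FluidPDE.NashGeometricRational

open Literature.Analysis.FluidPDE.NashGeometric (Pair Index idMat idMat_apply_self
  idMat_apply_of_ne abs_sub_idMat_le sum_sum_ite_ne sum_pair_eq_sum_dite)

variable {d : Type*}

/-! ## Directions `5e_i`, `3e_i ± 4e_j` and their normals `5e_{i'}`, `4e_i ∓ 3e_j` -/

section Directions

variable [DecidableEq d]

/-- The lattice directions `k_x ∈ ℤ^d`: `5e_i` for `x = i`, and `3e_i + 4e_j` resp. `3e_i - 4e_j`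
for the two copies of the ordered pair `(i, j)`, `i ≠ j` (five times rational unit vectors).
[cite: CheskidovDaiPalasek2025, §3.2] -/
def dir : Index d → d → ℤ :=
  Sum.elim (fun i => 5 • Pi.single i 1)
    (Sum.elim (fun p => 3 • Pi.single p.1.1 1 + 4 • Pi.single p.1.2 1)
      (fun p => 3 • Pi.single p.1.1 1 - 4 • Pi.single p.1.2 1))

open Classical in
/-- Some index different from `i` (a genuine one as soon as `d` has two elements). [folklore] -/
def other (i : d) : d := if h : ∃ j, j ≠ i then h.choose else i

/-- `other i ≠ i` when `d ≥ 2`. [folklore] -/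
theorem other_ne [Fintype d] (hd : 2 ≤ Fintype.card d) (i : d) : other i ≠ i := by
  have h : ∃ j, j ≠ i := by
    obtain ⟨a, b, hab⟩ := Fintype.exists_pair_of_one_lt_card (by omega : 1 < Fintype.card d)
    by_cases ha : a = i
    · exact ⟨b, fun hb => hab (ha.trans hb.symm)⟩
    · exact ⟨a, ha⟩
  have h1 : other i = h.choose := by
    rw [other, dif_pos h]
  rw [h1]
  exact h.choose_spec

/-- The lattice normals `k_x^⊥ ∈ ℤ^d`: `5e_{i'}` (`i' = other i ≠ i`) for `x = i`, and
`4e_i - 3e_j` resp. `4e_i + 3e_j` for the two copies of the pair `(i, j)`.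
[cite: CheskidovDaiPalasek2025, §3.2] -/
def perp : Index d → d → ℤ :=
  Sum.elim (fun i => 5 • Pi.single (other i) 1)
    (Sum.elim (fun p => 4 • Pi.single p.1.1 1 - 3 • Pi.single p.1.2 1)
      (fun p => 4 • Pi.single p.1.1 1 + 3 • Pi.single p.1.2 1))

/-- Entries of the directions as reals: `(5e_i)_q = 5δ_qi`, `(3e_i ± 4e_j)_q = 3δ_qi ± 4δ_qj`.
[folklore] -/
theorem dir_apply_cast (x : Index d) (q : d) : ((dir x q : ℤ) : ℝ) =
    Sum.elim (fun i => 5 * (if q = i then (1 : ℝ) else 0))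
      (Sum.elim (fun p => 3 * (if q = p.1.1 then (1 : ℝ) else 0) + 4 * (if q = p.1.2 then 1 else 0))
        (fun p => 3 * (if q = p.1.1 then (1 : ℝ) else 0) - 4 * (if q = p.1.2 then 1 else 0))) x := by
  rcases x with i | p | p <;> simp [dir, Pi.single_apply, Int.cast_ite]

/-- Entries of the normals as reals: `(5e_{i'})_q = 5δ_qi'`, `(4e_i ∓ 3e_j)_q = 4δ_qi ∓ 3δ_qj`.
[folklore] -/
theorem perp_apply_cast (x : Index d) (q : d) : ((perp x q : ℤ) : ℝ) =
    Sum.elim (fun i => 5 * (if q = other i then (1 : ℝ) else 0))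
      (Sum.elim (fun p => 4 * (if q = p.1.1 then (1 : ℝ) else 0) - 3 * (if q = p.1.2 then 1 else 0))
        (fun p => 4 * (if q = p.1.1 then (1 : ℝ) else 0) + 3 * (if q = p.1.2 then 1 else 0))) x := by
  rcases x with i | p | p <;> simp [perp, Pi.single_apply, Int.cast_ite]

/-- The rational unit directions `θ_x = k_x/5 ∈ 𝕊^{d-1} ∩ ℚ^d`. [cite: CheskidovDaiPalasek2025, §3.2] -/
def theta (x : Index d) : d → ℝ := fun l => ((dir x l : ℤ) : ℝ) / 5

/-- The rational unit normals `η_x = k_x^⊥/5 ∈ 𝕊^{d-1} ∩ ℚ^d`. [cite: CheskidovDaiPalasek2025, §3.2] -/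
def eta (x : Index d) : d → ℝ := fun l => ((perp x l : ℤ) : ℝ) / 5

/-- `5 θ_x = k_x ∈ ℤ^d` (`m_* = 5` clears the denominators of all `θ_x`).
[cite: CheskidovDaiPalasek2025, §3.2] -/
theorem five_mul_theta (x : Index d) (l : d) : 5 * theta x l = ((dir x l : ℤ) : ℝ) := by
  simp only [theta]
  ring

/-- `5 η_x = k_x^⊥ ∈ ℤ^d` (`m_* η_j ∈ ℤ^d` with `m_* = 5`). [cite: CheskidovDaiPalasek2025, §3.2] -/
theorem five_mul_eta (x : Index d) (l : d) : 5 * eta x l = ((perp x l : ℤ) : ℝ) := by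
  simp only [eta]
  ring

variable [Fintype d]

omit [DecidableEq d] in
/-- `∑_l (α δ_li + β δ_lj)(γ δ_li + δ' δ_lj) = αγ + βδ'` for `i ≠ j`. [folklore] -/
theorem sum_ind_mul_ind [DecidableEq d] {i j : d} (hij : i ≠ j) (α β γ δ : ℝ) :
    ∑ l, (α * (if l = i then (1 : ℝ) else 0) + β * (if l = j then 1 else 0)) *
      (γ * (if l = i then (1 : ℝ) else 0) + δ * (if l = j then 1 else 0)) = α * γ + β * δ := by
  have h1 : ∀ l, (α * (if l = i then (1 : ℝ) else 0) + β * (if l = j then 1 else 0)) *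
      (γ * (if l = i then (1 : ℝ) else 0) + δ * (if l = j then 1 else 0)) =
      (if l = i then α * γ else 0) + (if l = j then β * δ else 0) := by
    intro l
    by_cases hi : l = i
    · subst hi
      simp [hij]
    · by_cases hj : l = j
      · subst hj
        simp [hi]
      · simp [hi, hj]
  simp_rw [h1]
  rw [Finset.sum_add_distrib, Finset.sum_ite_eq' Finset.univ i, Finset.sum_ite_eq' Finset.univ j]
  simp

omit [DecidableEq d] in
/-- `∑_l (α δ_li)(β δ_lj) = δ_ij αβ`-type evaluation: `∑_l (α δ_li)(β δ_li') = 0` for `i' ≠ i`,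
and `∑_l (α δ_li)² = α²`. [folklore] -/
theorem sum_ind_mul_ind' [DecidableEq d] (i i' : d) (α β : ℝ) :
    ∑ l, (α * (if l = i then (1 : ℝ) else 0)) * (β * (if l = i' then 1 else 0)) =
      if i = i' then α * β else 0 := by
  have h1 : ∀ l, (α * (if l = i then (1 : ℝ) else 0)) * (β * (if l = i' then 1 else 0)) =
      if l = i then (if i = i' then α * β else 0) else 0 := by
    intro l
    by_cases hi : l = i
    · subst hi
      by_cases hi' : l = i' <;> simp [hi']
    · simp [hi]
  simp_rw [h1]
  rw [Finset.sum_ite_eq' Finset.univ i]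
  simp

/-- `|k_x|² = 25` for all directions (`25`, `9 + 16`, `9 + 16`). [folklore] -/
theorem sum_sq_dir (x : Index d) : ∑ l, ((dir x l : ℤ) : ℝ) ^ 2 = 25 := by
  rcases x with i | ⟨⟨i, j⟩, hij⟩ | ⟨⟨i, j⟩, hij⟩
  · simp only [dir_apply_cast, Sum.elim_inl, sq]
    rw [sum_ind_mul_ind' i i]
    norm_num
  · dsimp only at hij
    simp only [dir_apply_cast, Sum.elim_inr, Sum.elim_inl, sq]
    rw [sum_ind_mul_ind hij]
    norm_num
  · dsimp only at hij
    simp only [dir_apply_cast, Sum.elim_inr, sq, sub_eq_add_neg, neg_mul_eq_neg_mul]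
    rw [sum_ind_mul_ind hij]
    norm_num

/-- `|k_x^⊥|² = 25` for all normals. [folklore] -/
theorem sum_sq_perp (x : Index d) : ∑ l, ((perp x l : ℤ) : ℝ) ^ 2 = 25 := by
  rcases x with i | ⟨⟨i, j⟩, hij⟩ | ⟨⟨i, j⟩, hij⟩
  · simp only [perp_apply_cast, Sum.elim_inl, sq]
    rw [sum_ind_mul_ind' (other i) (other i)]
    norm_num
  · dsimp only at hij
    simp only [perp_apply_cast, Sum.elim_inr, Sum.elim_inl, sq, sub_eq_add_neg, neg_mul_eq_neg_mul]
    rw [sum_ind_mul_ind hij]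
    norm_num
  · dsimp only at hij
    simp only [perp_apply_cast, Sum.elim_inr, sq]
    rw [sum_ind_mul_ind hij]
    norm_num

/-- **Orthogonality** `k_x · k_x^⊥ = 0` (`5e_i · 5e_{i'} = 0` as `i' ≠ i`;
`(3e_i ± 4e_j) · (4e_i ∓ 3e_j) = 12 - 12 = 0`), `d ≥ 2`. [cite: CheskidovDaiPalasek2025, §3.2] -/
theorem sum_dir_mul_perp (hd : 2 ≤ Fintype.card d) (x : Index d) :
    ∑ l, ((dir x l : ℤ) : ℝ) * ((perp x l : ℤ) : ℝ) = 0 := by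
  rcases x with i | ⟨⟨i, j⟩, hij⟩ | ⟨⟨i, j⟩, hij⟩
  · have h : i ≠ other i := (other_ne hd i).symm
    simp only [dir_apply_cast, perp_apply_cast, Sum.elim_inl]
    rw [sum_ind_mul_ind' i (other i), if_neg h]
  · dsimp only at hij
    simp only [dir_apply_cast, perp_apply_cast, Sum.elim_inr, Sum.elim_inl, sub_eq_add_neg,
      neg_mul_eq_neg_mul]
    rw [sum_ind_mul_ind hij]
    norm_num
  · dsimp only at hij
    simp only [dir_apply_cast, perp_apply_cast, Sum.elim_inr, sub_eq_add_neg, neg_mul_eq_neg_mul]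
    rw [sum_ind_mul_ind hij]
    norm_num

/-- The directions are nonzero lattice vectors. [folklore] -/
theorem dir_ne_zero (x : Index d) : dir x ≠ 0 := by
  intro h
  have hs := sum_sq_dir x
  rw [h] at hs
  simp at hs

/-- The normals are nonzero lattice vectors. [folklore] -/
theorem perp_ne_zero (x : Index d) : perp x ≠ 0 := by
  intro h
  have hs := sum_sq_perp x
  rw [h] at hs
  simp at hs

/-- `|θ_x| = 1`: `∑_l θ_x(l)² = 1`. [cite: CheskidovDaiPalasek2025, §3.2] -/
theorem sum_sq_theta (x : Index d) : ∑ l, theta x l ^ 2 = 1 := by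
  have h := sum_sq_dir x
  simp only [theta, div_eq_mul_inv, mul_pow]
  rw [← Finset.sum_mul, h]
  norm_num

/-- `|η_x| = 1`: `∑_l η_x(l)² = 1`. [cite: CheskidovDaiPalasek2025, §3.2] -/
theorem sum_sq_eta (x : Index d) : ∑ l, eta x l ^ 2 = 1 := by
  have h := sum_sq_perp x
  simp only [eta, div_eq_mul_inv, mul_pow]
  rw [← Finset.sum_mul, h]
  norm_num

/-- `θ_x · η_x = 0`, `d ≥ 2`. [cite: CheskidovDaiPalasek2025, §3.2] -/
theorem sum_theta_mul_eta (hd : 2 ≤ Fintype.card d) (x : Index d) :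
    ∑ l, theta x l * eta x l = 0 := by
  have h := sum_dir_mul_perp hd x
  have h1 : ∀ l, theta x l * eta x l = ((dir x l : ℤ) : ℝ) * ((perp x l : ℤ) : ℝ) * (1 / 25) := by
    intro l
    simp only [theta, eta]
    ring
  simp_rw [h1]
  rw [← Finset.sum_mul, h, zero_mul]

end Directions

/-! ## The radius and the coefficients -/

section Coefficients

variable [Fintype d]

variable (d) in
/-- The radius `r_d = 6/(25(d-1))` of the lemma (positive for `d ≥ 2`). [folklore] -/
def radius : ℝ := 6 / (25 * ((Fintype.card d : ℝ) - 1))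

/-- The squared coefficients `Γ_x(M)²`, affine functionals of `M`:
`Γ²_{5e_i}(M) = M_ii - 1/2`, `Γ²_{3e_i + 4e_j}(M) = (25/48)(2r_d + M_ij)`,
`Γ²_{3e_i - 4e_j}(M) = (25/48)(2r_d - M_ij)`. [cite: CheskidovDaiPalasek2025, proof of Lemma 3.2] -/
def coeffSq (M : d → d → ℝ) : Index d → ℝ :=
  Sum.elim (fun i => M i i - 1 / 2)
    (Sum.elim (fun p => 25 / 48 * (2 * radius d + M p.1.1 p.1.2))
      (fun p => 25 / 48 * (2 * radius d - M p.1.1 p.1.2)))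

/-- The coefficients `Γ_x(M) = √(Γ_x(M)²)` (genuine square roots on `B̄(Id, 2r_d)`).
[cite: CheskidovDaiPalasek2025, proof of Lemma 3.2] -/
def coeff (x : Index d) (M : d → d → ℝ) : ℝ := Real.sqrt (coeffSq M x)

/-- `Γ²_{5e_i}(M) = M_ii - 1/2`. [folklore] -/
@[simp] theorem coeffSq_inl (M : d → d → ℝ) (i : d) : coeffSq M (Sum.inl i) = M i i - 1 / 2 := rfl

/-- `Γ²_{3e_i + 4e_j}(M) = (25/48)(2r_d + M_ij)`. [folklore] -/
@[simp] theorem coeffSq_inr_inl (M : d → d → ℝ) (p : Pair d) :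
    coeffSq M (Sum.inr (Sum.inl p)) = 25 / 48 * (2 * radius d + M p.1.1 p.1.2) := rfl

/-- `Γ²_{3e_i - 4e_j}(M) = (25/48)(2r_d - M_ij)`. [folklore] -/
@[simp] theorem coeffSq_inr_inr (M : d → d → ℝ) (p : Pair d) :
    coeffSq M (Sum.inr (Sum.inr p)) = 25 / 48 * (2 * radius d - M p.1.1 p.1.2) := rfl

section Card

variable (hd : 2 ≤ Fintype.card d)
include hd

/-- `0 < r_d`. [folklore] -/
theorem radius_pos : 0 < radius d := by
  have := NashGeometric.one_le_card_sub_one hd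
  unfold radius
  positivity

/-- `r_d ≤ 6/25`. [folklore] -/
theorem radius_le : radius d ≤ 6 / 25 := by
  have h := NashGeometric.one_le_card_sub_one hd
  unfold radius
  rw [div_le_div_iff₀ (by positivity) (by norm_num)]
  nlinarith

/-- The calibration `50 · (25/48 · 2r_d) · (d - 1) = 25/2` behind the diagonal entries. [folklore] -/
theorem radius_calibration :
    50 * (25 / 48 * (2 * radius d)) * ((Fintype.card d : ℝ) - 1) = 25 / 2 := by
  have h := NashGeometric.one_le_card_sub_one hd
  unfold radius
  field_simp
  ring

end Card

end Coefficients

/-! ## The linear identity and the decomposition -/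

section Identity

variable [Fintype d] [DecidableEq d]

/-- The axis family contributes `25 δ_ab (M_aa - 1/2)`. [folklore] -/
theorem sum_inl_coeffSq (M : d → d → ℝ) (a b : d) :
    ∑ i : d, coeffSq M (Sum.inl i) *
        (((dir (Sum.inl i : Index d) a : ℤ) : ℝ) * ((dir (Sum.inl i : Index d) b : ℤ) : ℝ)) =
      if a = b then 25 * (M a a - 1 / 2) else 0 := by
  simp only [coeffSq, Sum.elim_inl, dir_apply_cast, mul_ite, mul_one, mul_zero, ite_mul, zero_mul,
    Finset.sum_ite_eq, Finset.mem_univ, if_true]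
  by_cases hab : a = b
  · subst hab
    simp
    ring
  · simp [hab]

/-- The two pair families together contribute
`δ_ab (50 (25/48 · 2r_d)(d-1) - 25 M_aa) + 25 (M_ab + M_ba)/2`: termwise,
`(25/48)(2r_d + M_ij)(3δ_ai + 4δ_aj)(3δ_bi + 4δ_bj) + (25/48)(2r_d - M_ij)(3δ_ai - 4δ_aj)(3δ_bi - 4δ_bj)
  = 2 (25/48 · 2r_d)(9 δ_ai δ_bi + 16 δ_aj δ_bj) + (25/2) M_ij (δ_ai δ_bj + δ_aj δ_bi)`,
summed over `i ≠ j`. [folklore] -/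
theorem sum_inr_coeffSq (M : d → d → ℝ) (a b : d) :
    ∑ p : Pair d, coeffSq M (Sum.inr (Sum.inl p)) *
        (((dir (Sum.inr (Sum.inl p) : Index d) a : ℤ) : ℝ) *
          ((dir (Sum.inr (Sum.inl p) : Index d) b : ℤ) : ℝ)) +
      ∑ p : Pair d, coeffSq M (Sum.inr (Sum.inr p)) *
        (((dir (Sum.inr (Sum.inr p) : Index d) a : ℤ) : ℝ) *
          ((dir (Sum.inr (Sum.inr p) : Index d) b : ℤ) : ℝ)) =
      (if a = b then 50 * (25 / 48 * (2 * radius d)) * ((Fintype.card d : ℝ) - 1) - 25 * M a a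
        else 0) + 25 * (M a b + M b a) / 2 := by
  set T : d → d → ℝ := fun i j =>
    2 * (25 / 48 * (2 * radius d)) * (9 * ((if a = i then (1 : ℝ) else 0) * (if b = i then 1 else 0)) +
        16 * ((if a = j then (1 : ℝ) else 0) * (if b = j then 1 else 0))) +
      25 / 2 * M i j * ((if a = i then (1 : ℝ) else 0) * (if b = j then 1 else 0) +
        (if a = j then (1 : ℝ) else 0) * (if b = i then 1 else 0)) with hT
  rw [← Finset.sum_add_distrib]
  have hcomb : ∀ p : Pair d, coeffSq M (Sum.inr (Sum.inl p)) *
        (((dir (Sum.inr (Sum.inl p) : Index d) a : ℤ) : ℝ) *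
          ((dir (Sum.inr (Sum.inl p) : Index d) b : ℤ) : ℝ)) +
      coeffSq M (Sum.inr (Sum.inr p)) *
        (((dir (Sum.inr (Sum.inr p) : Index d) a : ℤ) : ℝ) *
          ((dir (Sum.inr (Sum.inr p) : Index d) b : ℤ) : ℝ)) =
      T p.1.1 p.1.2 := by
    intro p
    simp only [coeffSq, Sum.elim_inl, Sum.elim_inr, dir_apply_cast, hT]
    ring
  rw [Finset.sum_congr rfl fun p _ => hcomb p, sum_pair_eq_sum_dite]
  simp only [dite_eq_ite]
  rw [sum_sum_ite_ne T]
  simp only [hT, mul_add, Finset.sum_add_distrib, mul_ite, mul_one, mul_zero, Finset.sum_ite_eq,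
    Finset.mem_univ, if_true, Finset.sum_const, Finset.card_univ, nsmul_eq_mul, Finset.sum_ite_irrel]
  by_cases hab : a = b
  · subst hab
    simp only [if_true]
    ring
  · simp only [hab, if_false]
    ring

/-- **The linear identity** `∑_x Γ_x(M)² (k_x)_a (k_x)_b = 25 (M_ab + M_ba)/2` for EVERY matrix `M`,
`d ≥ 2`. [cite: CheskidovDaiPalasek2025, proof of Lemma 3.2 (rank-one decomposition)] -/
theorem sum_coeffSq_mul_dir_mul_dir (hd : 2 ≤ Fintype.card d) (M : d → d → ℝ) (a b : d) :
    ∑ x, coeffSq M x * (((dir x a : ℤ) : ℝ) * ((dir x b : ℤ) : ℝ)) = 25 * (M a b + M b a) / 2 := by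
  rw [Fintype.sum_sum_type, Fintype.sum_sum_type, sum_inl_coeffSq, sum_inr_coeffSq,
    radius_calibration hd]
  by_cases hab : a = b
  · subst hab
    simp only [if_true]
    ring
  · simp only [hab, if_false]
    ring

/-- **The identity for symmetric matrices along the unit directions**:
`M_ab = ∑_x Γ_x(M)² θ_x(a) θ_x(b)` for every symmetric `M`, `d ≥ 2` (affine `Γ_x²`, no
smallness needed). [cite: CheskidovDaiPalasek2025, proof of Lemma 3.2] -/
theorem nash_identity_theta (hd : 2 ≤ Fintype.card d) {M : d → d → ℝ}
    (hsym : ∀ i j, M i j = M j i) (a b : d) :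
    M a b = ∑ x, coeffSq M x * (theta x a * theta x b) := by
  have h := sum_coeffSq_mul_dir_mul_dir hd M a b
  have h1 : ∀ x : Index d, coeffSq M x * (theta x a * theta x b) =
      coeffSq M x * (((dir x a : ℤ) : ℝ) * ((dir x b : ℤ) : ℝ)) / 25 := by
    intro x
    simp only [theta]
    ring
  have h2 : ∀ x : Index d, coeffSq M x * (((dir x a : ℤ) : ℝ) * ((dir x b : ℤ) : ℝ)) / 25 =
      coeffSq M x * (((dir x a : ℤ) : ℝ) * ((dir x b : ℤ) : ℝ)) * (1 / 25) := fun x => by ring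
  simp_rw [h1, h2]
  rw [← Finset.sum_mul, h, ← hsym a b]
  ring

/-! ### Signs of the squared coefficients near `Id` -/

/-- On the closed sup-ball `B̄(Id, 2r_d)` all squared coefficients are nonnegative:
`M_ii - 1/2 ≥ 1/2 - 2r_d ≥ 1/50` and `2r_d ± M_ij ≥ 0`. [folklore] -/
theorem coeffSq_nonneg (hd : 2 ≤ Fintype.card d) {M : d → d → ℝ}
    (hM : dist M idMat ≤ 2 * radius d) (x : Index d) : 0 ≤ coeffSq M x := by
  have hr := radius_le hd
  rcases x with i | ⟨⟨i, j⟩, hij⟩ | ⟨⟨i, j⟩, hij⟩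
  · have h := abs_sub_idMat_le hM i i
    rw [idMat_apply_self] at h
    have := (abs_le.mp h).1
    simp only [coeffSq_inl]
    linarith
  · dsimp only at hij
    have h := abs_sub_idMat_le hM i j
    rw [idMat_apply_of_ne hij, sub_zero] at h
    have := (abs_le.mp h).1
    simp only [coeffSq_inr_inl]
    nlinarith
  · dsimp only at hij
    have h := abs_sub_idMat_le hM i j
    rw [idMat_apply_of_ne hij, sub_zero] at h
    have := (abs_le.mp h).2
    simp only [coeffSq_inr_inr]
    nlinarith

/-- On the open sup-ball `B(Id, 2r_d)` all squared coefficients are positive. [folklore] -/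
theorem coeffSq_pos (hd : 2 ≤ Fintype.card d) {M : d → d → ℝ}
    (hM : dist M idMat < 2 * radius d) (x : Index d) : 0 < coeffSq M x := by
  have hr := radius_le hd
  have hlt : ∀ i j, |M i j - idMat i j| < 2 * radius d := fun i j =>
    lt_of_le_of_lt ((dist_le_pi_dist (M i) (idMat i) j).trans (dist_le_pi_dist M idMat i))
      (by simpa [Real.dist_eq] using hM)
  rcases x with i | ⟨⟨i, j⟩, hij⟩ | ⟨⟨i, j⟩, hij⟩
  · have h := hlt i i
    rw [idMat_apply_self] at h
    have := (abs_lt.mp h).1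
    simp only [coeffSq_inl]
    linarith
  · dsimp only at hij
    have h := hlt i j
    rw [idMat_apply_of_ne hij, sub_zero] at h
    have := (abs_lt.mp h).1
    simp only [coeffSq_inr_inl]
    nlinarith
  · dsimp only at hij
    have h := hlt i j
    rw [idMat_apply_of_ne hij, sub_zero] at h
    have := (abs_lt.mp h).2
    simp only [coeffSq_inr_inr]
    nlinarith

/-- **Uniform positivity on `B̄(Id, r_d)`**: `Γ_x(M)² ≥ r_d/2`
(`M_ii - 1/2 ≥ 1/2 - r_d ≥ 13/50 ≥ r_d/2` and `(25/48)(2r_d ± M_ij) ≥ (25/48) r_d ≥ r_d/2`). [folklore] -/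
theorem le_coeffSq (hd : 2 ≤ Fintype.card d) {M : d → d → ℝ} (hM : dist M idMat ≤ radius d)
    (x : Index d) : radius d / 2 ≤ coeffSq M x := by
  have hr := radius_le hd
  have hr0 := radius_pos hd
  rcases x with i | ⟨⟨i, j⟩, hij⟩ | ⟨⟨i, j⟩, hij⟩
  · have h := abs_sub_idMat_le hM i i
    rw [idMat_apply_self] at h
    have := (abs_le.mp h).1
    simp only [coeffSq_inl]
    linarith
  · dsimp only at hij
    have h := abs_sub_idMat_le hM i j
    rw [idMat_apply_of_ne hij, sub_zero] at h
    have := (abs_le.mp h).1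
    simp only [coeffSq_inr_inl]
    nlinarith
  · dsimp only at hij
    have h := abs_sub_idMat_le hM i j
    rw [idMat_apply_of_ne hij, sub_zero] at h
    have := (abs_le.mp h).2
    simp only [coeffSq_inr_inr]
    nlinarith

/-- `Γ_x(M)² = (Γ_x(M))²` on `B̄(Id, 2r_d)` (the square root is genuine there). [folklore] -/
theorem coeff_sq (hd : 2 ≤ Fintype.card d) {M : d → d → ℝ} (hM : dist M idMat ≤ 2 * radius d)
    (x : Index d) : coeff x M ^ 2 = coeffSq M x :=
  Real.sq_sqrt (coeffSq_nonneg hd hM x)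

/-- `r_d/2 ≤ Γ_x(M)²` on `B̄(Id, r_d)`, for the genuine coefficient `Γ_x = √(Γ_x²)`. [folklore] -/
theorem le_coeff_sq (hd : 2 ≤ Fintype.card d) {M : d → d → ℝ} (hM : dist M idMat ≤ radius d)
    (x : Index d) : radius d / 2 ≤ coeff x M ^ 2 := by
  rw [coeff_sq hd (hM.trans (by linarith [radius_pos hd])) x]
  exact le_coeffSq hd hM x

/-- **The rank-one decomposition along rational unit directions**
`M_ab = ∑_x Γ_x(M)² θ_x(a) θ_x(b)`, i.e. `M = ∑_x Γ_x(M)² θ_x ⊗ θ_x`, for every symmetric `M` in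
the closed sup-ball `B̄(Id, 2r_d)`, `d ≥ 2`. [cite: CheskidovDaiPalasek2025, proof of Lemma 3.2] -/
theorem decomposition_theta (hd : 2 ≤ Fintype.card d) {M : d → d → ℝ}
    (hsym : ∀ i j, M i j = M j i) (hM : dist M idMat ≤ 2 * radius d) (a b : d) :
    M a b = ∑ x, coeff x M ^ 2 * (theta x a * theta x b) := by
  rw [nash_identity_theta hd hsym a b]
  exact Finset.sum_congr rfl fun x _ => by rw [coeff_sq hd hM x]

/-- The same decomposition with the lattice vectors: `M_ab = ∑_x Γ_x(M)² (k_x)_a (k_x)_b / 25`.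
[cite: CheskidovDaiPalasek2025, proof of Lemma 3.2] -/
theorem decomposition (hd : 2 ≤ Fintype.card d) {M : d → d → ℝ}
    (hsym : ∀ i j, M i j = M j i) (hM : dist M idMat ≤ 2 * radius d) (a b : d) :
    M a b = ∑ x, coeff x M ^ 2 * (((dir x a : ℤ) : ℝ) * ((dir x b : ℤ) : ℝ) / 25) := by
  rw [decomposition_theta hd hsym hM a b]
  refine Finset.sum_congr rfl fun x _ => ?_
  simp only [theta]
  ring

/-! ## Smoothness -/

omit [DecidableEq d] in
/-- Each `Γ_x²` is `C^∞` on all of `ℝ^{d×d}` (an affine function of one entry). [folklore] -/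
theorem contDiff_coeffSq (x : Index d) {n : WithTop ℕ∞} :
    ContDiff ℝ n fun M : d → d → ℝ => coeffSq M x := by
  have h : ∀ i j : d, ContDiff ℝ n fun M : d → d → ℝ => M i j :=
    fun i j => contDiff_apply_apply ℝ ℝ i j
  rcases x with i | p | p
  · simp only [coeffSq_inl]
    exact (h i i).sub contDiff_const
  · simp only [coeffSq_inr_inl]
    exact contDiff_const.mul (contDiff_const.add (h p.1.1 p.1.2))
  · simp only [coeffSq_inr_inr]
    exact contDiff_const.mul (contDiff_const.sub (h p.1.1 p.1.2))

/-- **Each `Γ_x` is `C^∞` on the open sup-ball `B(Id, 2r_d)`** (square root of a smooth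
positive function), `d ≥ 2`: the paper's "`Γ_j : B(Id, c₀) → ℝ` are smooth".
[cite: CheskidovDaiPalasek2025, proof of Lemma 3.2] -/
theorem contDiffOn_coeff (hd : 2 ≤ Fintype.card d) (x : Index d) {n : WithTop ℕ∞} :
    ContDiffOn ℝ n (coeff x) (ball (idMat : d → d → ℝ) (2 * radius d)) :=
  (contDiff_coeffSq x).contDiffOn.sqrt fun _ hM => (coeffSq_pos hd (mem_ball.mp hM) x).ne'

/-- `Γ_x` is `C^∞` at every point of the open ball `B(Id, 2r_d)`. [folklore] -/
theorem contDiffAt_coeff (hd : 2 ≤ Fintype.card d) (x : Index d) {n : WithTop ℕ∞}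
    {M : d → d → ℝ} (hM : dist M idMat < 2 * radius d) : ContDiffAt ℝ n (coeff x) M :=
  (contDiffOn_coeff hd x).contDiffAt (isOpen_ball.mem_nhds (mem_ball.mpr hM))

/-- **Uniform bounds on all derivatives of `Γ_x` on `B̄(Id, r_d)`**: for every `m` there is `C`
with `‖D^m Γ_x(M)‖ ≤ C` whenever `dist M Id ≤ r_d`. [folklore] -/
theorem exists_bound_iteratedFDeriv_coeff (hd : 2 ≤ Fintype.card d) (x : Index d) (m : ℕ) :
    ∃ C : ℝ, ∀ M : d → d → ℝ, dist M idMat ≤ radius d →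
      ‖iteratedFDeriv ℝ m (coeff x) M‖ ≤ C := by
  set U : Set (d → d → ℝ) := ball idMat (2 * radius d) with hU
  have hUopen : IsOpen U := isOpen_ball
  have hsmooth : ContDiffOn ℝ ∞ (coeff x) U := contDiffOn_coeff hd x
  have hcont : ContinuousOn (iteratedFDerivWithin ℝ m (coeff x) U) U :=
    hsmooth.continuousOn_iteratedFDerivWithin (by exact_mod_cast le_top) hUopen.uniqueDiffOn
  have hcont' : ContinuousOn (iteratedFDeriv ℝ m (coeff x)) U :=
    hcont.congr fun M hM => (iteratedFDerivWithin_of_isOpen m hUopen hM).symm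
  have hsub : closedBall idMat (radius d) ⊆ U := by
    intro M hM
    rw [hU, mem_ball]
    exact (mem_closedBall.mp hM).trans_lt (by linarith [radius_pos hd])
  obtain ⟨C, hC⟩ := (isCompact_closedBall idMat (radius d)).exists_bound_of_continuousOn
    (hcont'.mono hsub)
  exact ⟨C, fun M hM => hC M (mem_closedBall.mpr hM)⟩

/-! ## The lemma in the shape consumed by §3.2 -/

/-- **The geometric lemma with rational unit directions and normals (every `d ≥ 2`)**: there
is `r > 0` (namely `r = 6/(25(d-1))`) such that the finitely many unit vectors
`θ_x = k_x/5 ∈ ℚ^d` (`k_x ∈ ℤ^d`: `5e_i`, `3e_i ± 4e_j`) and `η_x = k_x^⊥/5 ∈ ℚ^d`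
(`5e_{i'}`, `4e_i ∓ 3e_j`) and the functions `Γ_x = coeff x` satisfy: `|θ_x| = |η_x| = 1`,
`θ_x · η_x = 0`, `5θ_x, 5η_x ∈ ℤ^d`; `Γ_x ∈ C^∞(B(Id, 2r))`; `M = ∑_x Γ_x(M)² θ_x ⊗ θ_x` for every
symmetric `M` with `dist M Id ≤ 2r` (in particular `Id` is generated with the positive
coefficients `Γ_x(Id)²`); `Γ_x(M)² ≥ r/2` for `dist M Id ≤ r`; and `sup_{B̄(Id,r)} ‖D^m Γ_x‖ < ∞`
for all `m`. This is the choice "`θ_j, η_j ∈ 𝕊^{d-1} ∩ ℚ^d`, `θ_j · η_j = 0`, … generate `Id` with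
positive coefficients, `m_* η_j ∈ ℤ^d`" of §3.2 together with the rank-one decomposition used
in the proof of Lemma 3.2 (over a finite family that need not be linearly independent).
[cite: CheskidovDaiPalasek2025, §3.2 and proof of Lemma 3.2] -/
theorem geometric_lemma (hd : 2 ≤ Fintype.card d) :
    ∃ r : ℝ, 0 < r ∧
      (∀ x : Index d, ∑ l, theta x l ^ 2 = 1) ∧ (∀ x : Index d, ∑ l, eta x l ^ 2 = 1) ∧
      (∀ x : Index d, ∑ l, theta x l * eta x l = 0) ∧
      (∀ (x : Index d) (l : d), 5 * theta x l = ((dir x l : ℤ) : ℝ)) ∧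
      (∀ (x : Index d) (l : d), 5 * eta x l = ((perp x l : ℤ) : ℝ)) ∧
      (∀ x : Index d, ContDiffOn ℝ ∞ (coeff x) (ball (idMat : d → d → ℝ) (2 * r))) ∧
      (∀ M : d → d → ℝ, (∀ i j, M i j = M j i) → dist M idMat ≤ 2 * r →
        ∀ a b, M a b = ∑ x, coeff x M ^ 2 * (theta x a * theta x b)) ∧
      (∀ M : d → d → ℝ, dist M idMat ≤ r → ∀ x : Index d, r / 2 ≤ coeff x M ^ 2) ∧
      ∀ (x : Index d) (m : ℕ), ∃ C : ℝ, ∀ M : d → d → ℝ, dist M idMat ≤ r →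
        ‖iteratedFDeriv ℝ m (coeff x) M‖ ≤ C :=
  ⟨radius d, radius_pos hd, sum_sq_theta, sum_sq_eta, sum_theta_mul_eta hd, five_mul_theta,
    five_mul_eta, fun x => contDiffOn_coeff hd x,
    fun _ hsym hM a b => decomposition_theta hd hsym hM a b, fun _ hM x => le_coeff_sq hd hM x,
    fun x m => exists_bound_iteratedFDeriv_coeff hd x m⟩

end Identity

end Literature.Analysis.FluidPDE.NashGeometricRational
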